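import Summits.QuantumAdvantage.QuantumAdvantage.Theorems.FlatDialFrame
import Literature.Computability.QuantumComplexity.MSubspaceSignReadoutRelaxedRuns

/-!
# FlatDialTrilin — module 12 of the lens-3 g11 «FlatDial» THEOREMS package (cell decomp-qadv): trilinear tables, adjoints, duality under frames

The generic algebra of the TABLE LEVEL (ii) of the `M`-recovery family (record §12): everything a prover needs to present the planted function
`cubeMM (m+1) ∘ frameA w` and its dual partner as CUBIC TABLES.

* §1 `apply_eq_bd_of_add` : an additive functional IS a linear form, `φ y = ⟨(φ e_c)_c, y⟩`; `perm_symm_bxor` (the inverse of an additive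
  bijection is additive); the ADJOINT `adjOf B v = (⟨v, B⁻¹ e_c⟩)_c` with ★ `bd_adjOf : ⟨v, B⁻¹ u⟩ = ⟨adjOf B v, u⟩`.
* §2 ★ `isDualOf_precomp` : if `D` is the dual of `F`, then `D ∘ C` is the dual of `F ∘ B` whenever `⟨v, B⁻¹u⟩ = ⟨C v, u⟩` (Walsh covariance
  under a linear frame, proved from scratch: a `15`-line change of variables); `mem_signedCubicDuals_of_isDualOf` : a function whose dual is
  presented by a cubic table is a signed cubic dual (`forrelation` symmetry `MMReadout.forrelation_symm'`).
* §3 ★ `triForm κ U` : the cubic table of a SUM OF PRODUCTS OF THREE LINEAR FORMS `⊕_t κ_t·⟨U_t⁰,y⟩⟨U_t¹,y⟩⟨U_t²,y⟩` (coefficient of the ORDERED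
  triple `(i,j,l)` = `⊕_t κ_t U_t⁰(i) U_t¹(j) U_t²(l)`; repeats encode degree `≤ 2`), and ★★ `eval_triForm` : it presents that function.

ZERO `def X : Prop`.  Provenance: HOME/decomp-qadv-lens-3/g11/ (record NODE-g11.md §12, LAND-g11.md step 12).
-/

set_option linter.dupNamespace false

noncomputable section

namespace Summit.QuantumAdvantage.QuantumAdvantage.Theorems.FlatDial

open Finset
open Literature.Computability.QuantumComplexity
open Literature.Computability.QuantumComplexity.BuzetChailloux (bxor zeroVec bxor_self)
open Literature.Computability.QuantumComplexity.DerivativeWalsh (W)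
open Summit.QuantumAdvantage.QuantumAdvantage.Theorems.HintDial (IsDualOf bit_and bit_injective bit_decide_odd bit_eq_ite eval_bit
  forrelation_eq_one_of_isDualOf)
open Summit.QuantumAdvantage.QuantumAdvantage.Theorems.HintDial.Automaton (bd sgl bd_sgl_left bd_sgl_right bd_bxor_right signOf_bd bit_bd)
open CubicForm (bit)

/-! ## 1. Additive maps are linear forms; adjoints -/

section Additive

variable {n : ℕ}

/-- ★ an ADDITIVE functional is the linear form of its values on the unit vectors: `φ y = ⟨(φ e_c)_c, y⟩`. -/
theorem apply_eq_bd_of_add {φ : (Fin n → Bool) → Bool} (hφ : ∀ x y, φ (bxor x y) = xor (φ x) (φ y)) (y : Fin n → Bool) :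
    φ y = bd (fun c => φ (sgl c)) y := by
  classical
  suffices H : ∀ (s : Finset (Fin n)) (y : Fin n → Bool), (∀ c, y c = true → c ∈ s) → φ y = bd (fun c => φ (sgl c)) y from
    H univ y fun c _ => mem_univ c
  intro s
  induction s using Finset.induction_on with
  | empty =>
    intro y hy
    have h0 : y = zeroVec := funext fun c => by
      cases hc : y c
      · rfl
      · exact absurd (hy c hc) (Finset.notMem_empty c)
    rw [h0, map_zeroVec_of_add hφ, HintDial.Automaton.bd_zeroVec_right]
  | insert k s hks ih =>
    intro y hy
    cases hk : y k
    · refine ih y fun c hc => ?_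
      have hc' := hy c hc
      rw [mem_insert] at hc'
      rcases hc' with rfl | h
      · rw [hk] at hc; exact absurd hc Bool.false_ne_true
      · exact h
    · have e : y = bxor (bxor y (sgl k)) (sgl k) := by
        funext c; show y c = xor (xor (y c) (sgl k c)) (sgl k c); cases y c <;> cases sgl k c <;> rfl
      have hy' : ∀ c, bxor y (sgl k) c = true → c ∈ s := by
        intro c hc
        change xor (y c) (decide (c = k)) = true at hc
        by_cases hck : c = k
        · subst hck; rw [hk, decide_eq_true rfl] at hc; exact absurd hc (by decide)
        · rw [decide_eq_false hck, Bool.xor_false] at hc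
          have hc' := hy c hc
          rw [mem_insert] at hc'
          exact hc'.resolve_left hck
      conv_lhs => rw [e, hφ, ih _ hy', bd_bxor_right, bd_sgl_right]
      generalize bd (fun c => φ (sgl c)) y = P
      generalize φ (sgl k) = Q
      cases P <;> cases Q <;> rfl

/-- the inverse of an additive bijection is additive. -/
theorem perm_symm_bxor (B : Equiv.Perm (Fin n → Bool)) (hB : ∀ x y, B (bxor x y) = bxor (B x) (B y)) (x y : Fin n → Bool) :
    B.symm (bxor x y) = bxor (B.symm x) (B.symm y) := by
  apply B.injective
  rw [hB, Equiv.apply_symm_apply, Equiv.apply_symm_apply, Equiv.apply_symm_apply]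

/-- ★ THE ADJOINT (inverse transpose) of a bijection `B`, as a plain map: `(adjOf B v)_c = ⟨v, B⁻¹ e_c⟩`. -/
def adjOf (B : Equiv.Perm (Fin n → Bool)) (v : Fin n → Bool) : Fin n → Bool := fun c => bd v (B.symm (sgl c))

/-- ★ adjointness: `⟨v, B⁻¹ u⟩ = ⟨adjOf B v, u⟩` for an additive `B`. -/
theorem bd_adjOf (B : Equiv.Perm (Fin n → Bool)) (hB : ∀ x y, B (bxor x y) = bxor (B x) (B y)) (v u : Fin n → Bool) :
    bd v (B.symm u) = bd (adjOf B v) u := by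
  have hs := perm_symm_bxor B hB
  apply bit_injective
  rw [bit_bd, bit_bd]
  have e : ∀ i, bit (B.symm u i) = ∑ c, bit (B.symm (sgl c) i) * bit (u c) := fun i => by
    rw [apply_eq_bd_of_add (φ := fun u => B.symm u i) (fun x y => by rw [hs]) u]
    exact bit_bd _ _
  simp_rw [e, mul_sum, adjOf, bit_bd, sum_mul]
  rw [sum_comm]
  exact sum_congr rfl fun c _ => sum_congr rfl fun i _ => by ring

end Additive

/-! ## 2. Duality under a linear frame -/

section Walsh

variable {n : ℕ}

/-- ★ WALSH COVARIANCE: if `D` is the dual of `F` and `⟨v, B⁻¹u⟩ = ⟨C v, u⟩`, then `D ∘ C` is the dual of `F ∘ B`. [cite: Carlet2020, Def. 6.1.2] -/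
theorem isDualOf_precomp {F D : (Fin n → Bool) → Bool} (h : IsDualOf F D) (B : Equiv.Perm (Fin n → Bool))
    (C : (Fin n → Bool) → (Fin n → Bool)) (hC : ∀ v u, bd v (B.symm u) = bd (C v) u) :
    IsDualOf (fun x => F (B x)) fun v => D (C v) := by
  intro v
  have hv := h (C v)
  rw [DerivativeWalsh.W] at hv ⊢
  rw [← hv]
  refine Fintype.sum_equiv B _ _ fun x => ?_
  show signOf (F (B x)) * twist x v = signOf (F (B x)) * twist (B x) (C v)
  rw [← signOf_bd, ← signOf_bd, bd_comm (B x) (C v), ← hC, B.symm_apply_apply, bd_comm x v]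

/-- a function whose DUAL is presented by a cubic table is a signed cubic dual. -/
theorem mem_signedCubicDuals_of_isDualOf {G D : (Fin n → Bool) → Bool} (hD : IsDualOf G D) (F : CubicForm n) (hF : F.eval = D) :
    G ∈ signedCubicDuals n :=
  ⟨F, Or.inl (by rw [hF, ← MMReadout.forrelation_symm']; exact forrelation_eq_one_of_isDualOf hD)⟩

end Walsh

/-! ## 3. Trilinear tables -/

section Trilinear

variable {n : ℕ} {τ : Type} [Fintype τ]

/-- the bit of a parity is the sum of the bits. -/
theorem bit_odd_card (p : τ → Bool) : bit (decide (Odd (univ.filter fun t => p t = true).card)) = ∑ t, bit (p t) := by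
  rw [bit_decide_odd, Finset.natCast_card_filter]
  exact sum_congr rfl fun t _ => (bit_eq_ite (p t)).symm

/-- ★ THE CUBIC TABLE OF A SUM OF PRODUCTS OF THREE LINEAR FORMS `⊕_t κ_t·⟨U_t⁰,y⟩·⟨U_t¹,y⟩·⟨U_t²,y⟩`: the coefficient of the ordered
triple `(i,j,l)` is `⊕_t κ_t·U_t⁰(i)·U_t¹(j)·U_t²(l)` (on `{0,1}ⁿ`, `yᵢ² = yᵢ`, so repeated forms present degree `≤ 2` terms). -/
def triForm (n : ℕ) (κ : τ → Bool) (U : τ → Fin 3 → Fin n → Bool) : CubicForm n :=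
  ⟨false, fun i j l => decide (Odd (univ.filter fun t => (κ t && (U t 0 i && (U t 1 j && U t 2 l))) = true).card)⟩

/-- ★★ the trilinear table PRESENTS the sum of products. -/
theorem eval_triForm (κ : τ → Bool) (U : τ → Fin 3 → Fin n → Bool) (y : Fin n → Bool) :
    (triForm n κ U).eval y = decide (Odd (univ.filter fun t => (κ t && (bd (U t 0) y && (bd (U t 1) y && bd (U t 2) y))) = true).card) := by
  apply bit_injective
  rw [eval_bit, bit_odd_card]
  simp only [triForm, bit_odd_card, bit_and, bit_bd]
  rw [show bit false = 0 from rfl, zero_add]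
  simp only [Finset.sum_mul_sum]
  simp only [sum_mul, mul_sum]
  -- LHS `Σ i j l t`, RHS `Σ t i j l`: move `t` inward on the right
  conv_rhs => rw [sum_comm]
  refine sum_congr rfl fun i _ => ?_
  conv_rhs => rw [sum_comm]
  refine sum_congr rfl fun j _ => ?_
  conv_rhs => rw [sum_comm]
  refine sum_congr rfl fun l _ => sum_congr rfl fun t _ => by ring

end Trilinear

end Summit.QuantumAdvantage.QuantumAdvantage.Theorems.FlatDial
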